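import Mathlib
import HarnessLib
import HarnessLib.Audit
import Summits.ValiantsHypothesis.Statement
import Summits.ValiantsHypothesis.ValiantsHypothesis.Theorems.SymmetroidDescartesThetaPencilWitnessTheta
import Literature.Computability.AlgebraicComplexity.ValiantConjectureEquivProofs
import Literature.Computability.AlgebraicComplexity.HrubesSensitiveMonotone
import Literature.Computability.AlgebraicComplexity.ArithCircuitProofs
import Literature.Computability.AlgebraicComplexity.DeterminantalIdealComplexityDescent
import Literature.Barriers.ValiantsHypothesis.MonotoneGap
import Literature.Barriers.ValiantsHypothesis.MonotoneGapPermanentProofs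
import Literature.Computability.AlgebraicComplexity.SyntacticMultilinear
import Summits.ValiantsHypothesis.ValiantsHypothesis.Theorems.NcSemantics
import Literature.Computability.AlgebraicComplexity.NoncommutativeCircuits
import Summits.ValiantsHypothesis.ValiantsHypothesis.Theorems.OrderedCountWindow
import Summits.ValiantsHypothesis.ValiantsHypothesis.Theorems.TameSensitivityQuantHrubes
import HarnessLib.Audit.Status.Attr

/-!
Route: DecompCycle1

# Route DecompCycle1 — decomposition workshop cycle 1 (VALIANT) — TameSensitivity: VP≠VNP ⟺
PerNotTame ∧ TamePer, attacked through ε-sensitive monotone hardness of the permanent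

ROTATING DECOMPOSITION WORKSHOP cycle 1 = VALIANT (D-0170/0171/0172), summit S =
`ValiantsHypothesis` (VP_ℂ ≠ VNP_ℂ); LADDER-Valiant rung 0 —
NOTHING IN THIS FILE PROVES VP ≠ VNP. This is the cycle's Theses file of record: node
TameSensitivity (lens decomp-val-lens-6, restricted-models /
lifting axis), the FIRST node CLEARED by the critic (critic decomp-val-crit-1-g0 CLEARED
2026-08-29T17:58:46Z = CRITIC-LEDGER.md row 3 (probe file
HOME/critic/L6_TameSensitivity_v1_probe.lean
sha256=8a732ff073fb3381fce3239b1f47ae5edd44308238df06397a707025e1d8be4f)); OR-sibling nodes cleared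
later are born as separate files DecompCycle1B, … (critic NOTE
2026-08-29T17:58:46Z) and the whole AND/OR tree is kept in HOME/TREE.md. RESTRICTED MODEL = TAME
real circuits (fan-in-two circuits over ℝ whose
Hrubeš radius absEval P := eval at the all-ones point of P with every constant replaced by its
modulus is ≤ 2^(n^C+C)).
ROOT AND-node (exact): S ⟺ PerNotTame ∧ TamePer (writer lemma summit_iff_tame_split, lens
summit_iff_tame_split), where PerNotTame = "per_n has no
p-size tame circuits at any budget C, infinitely often" [WEAKER: S ⟹ it (lens perNotTame_of_summit),
converse open] and TamePer = (per ∈ VP_ℝ → per has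
p-size tame circuits) [DECLARED-RESIDUAL(PerNotTame): TamePer ⟺ (PerNotTame → S), writer/lens
tamePer_iff_residual; formally WEAKER = vacuous under S;
leaf IDEA-NEEDED]. ATTACK node: PerNotTame ⟸ SensitiveHardPoly ∧ QuantHrubesPer (Hrubeš's
ε-sensitive bridge at ε = 2^-(n^C+C); realised INSIDE
`closes`), SensitiveHardPoly = "for every C and p-bounded s, some n has NO ε ∈ [2^-(n^C+C), 1] with
U_n + ε·per_n monotone-computable in size
≤ s n", U_n = (1 + Σ x_ij)^n [WEAKER: S ⟹ it (lens sensitiveHardPoly_of_summit), converse open =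
TameTransfer; leaf ATTACKABLE, first rung
SensitiveHardAtOne = the (1+Σx)^n-form of Hrubeš 2020 §6 Open Problem 1], QuantHrubesPer = Hrubeš's
Theorem 1 for per_n with the explicit threshold
ε·absEval P ≤ 1 [support, PROVABLE-NOW]. Frame records (not items): MonotoneLift := (JS82 monotone
bound → per ∉ VP_ℝ) is bare-EQUIV to S
(lens monotoneLift_iff_summit) and PerMonotoneHard is PROVED (COSTUME-cite JerrumSnir1982, tree
JerrumSnir1982_permanent_holds) — admissible only
as the frame above the WEAKER piece SensitiveHardPoly; content line under TamePer: TamePer ⟸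
SmallConstPer ∧ TameGrowth (lens
tamePer_of_smallConst_growth; SmallConstPer = RESIDUAL of the weaker bound PerNotSmallConst, critic
probe — an unbalanced alternative, record only).
lens node file HOME/decomp-val-lens-6/TameSensitivity.lean
sha256=e28acd425e4e8d130e9f9e3d5e881333f445ed4d7ca5be3847560a57bea4c925 + NODE.md
sha256=1e2d9e34067919d0b81fa0a2f5cdccf3d02ebcd66541eaf952475fd9fa3859b7 (NODE decomp-val-lens-6-g0
2026-08-29T17:51:26Z); instrument data: HOME/census/COSTUME-CENSUS-v1.json
sha256=90724a8468526f3ea5b7c6e818438941d4992fba4436f0f78eb51c8ff82c2659 (29 rows; monotone row =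
INCOMPARABLE/JS82; natural-proofs row), COSTUME-CENSUS-v1.md
sha256=b0bac0d9225208473009ebc8cfaf255083f089a4e3af4b33781a91633534c025 (RESULT
decomp-val-census-1-g0 2026-08-29T17:33:40Z; critic READ row 1 with the B3 i.o./a.e. correction).
Lean: `(∀ (C : ℕ) (s : ℕ → ℕ), Literature.Computability.AlgebraicComplexity.IsPBounded s → ∃ n : ℕ,
∀ ε : ℝ, ((2 : ℝ) ^ (n ^ C + C))⁻¹ ≤ ε → ε ≤ 1 → ¬ (∃ (g : MvPolynomial (Fin n × Fin n) NNReal) (P :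
Literature.Computability.AlgebraicComplexity.ArithCircuit NNReal (Fin n × Fin n)), MvPolynomial.map
NNReal.toRealHom g = (1 + ∑ ij : Fin n × Fin n, MvPolynomial.X ij) ^ n + MvPolynomial.C ε *
Literature.Computability.AlgebraicComplexity.perPoly (Fin n) ℝ ∧
Literature.Barriers.ValiantsHypothesis.IsMonotoneComputation P g ∧ P.size ≤ s n)) ∧
(Literature.Computability.AlgebraicComplexity.IsPComputable (fun n =>
Literature.Computability.AlgebraicComplexity.perPoly (Fin n) ℝ) → ∃ (C : ℕ) (s : ℕ → ℕ),
Literature.Computability.AlgebraicComplexity.IsPBounded s ∧ ∀ n : ℕ, ∃ P :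
Literature.Computability.AlgebraicComplexity.ArithCircuit ℝ (Fin n × Fin n), P.IsFanInTwo ∧
P.Computes (Literature.Computability.AlgebraicComplexity.perPoly (Fin n) ℝ) ∧ P.size ≤ s n ∧
MvPolynomial.eval (fun _ => (1 : ℝ))
(Literature.Computability.AlgebraicComplexity.ArithCircuit.mapConsts (fun c : ℝ => |c|) P).eval ≤ (2
: ℝ) ^ (n ^ C + C)) ∧ (∃ t : ℕ → ℕ → ℕ, (∀ s : ℕ → ℕ,
Literature.Computability.AlgebraicComplexity.IsPBounded s →
Literature.Computability.AlgebraicComplexity.IsPBounded fun n => t n (s n)) ∧ ∀ (n : ℕ) (P :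
Literature.Computability.AlgebraicComplexity.ArithCircuit ℝ (Fin n × Fin n)) (m : ℕ), P.IsFanInTwo →
P.Computes (Literature.Computability.AlgebraicComplexity.perPoly (Fin n) ℝ) → P.size ≤ m → ∀ ε : ℝ,
0 < ε → ε ≤ 1 → ε * MvPolynomial.eval (fun _ => (1 : ℝ))
(Literature.Computability.AlgebraicComplexity.ArithCircuit.mapConsts (fun c : ℝ => |c|) P).eval ≤ 1
→ ∃ (g : MvPolynomial (Fin n × Fin n) NNReal) (P :
Literature.Computability.AlgebraicComplexity.ArithCircuit NNReal (Fin n × Fin n)), MvPolynomial.map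
NNReal.toRealHom g = (1 + ∑ ij : Fin n × Fin n, MvPolynomial.X ij) ^ n + MvPolynomial.C ε *
Literature.Computability.AlgebraicComplexity.perPoly (Fin n) ℝ ∧
Literature.Barriers.ValiantsHypothesis.IsMonotoneComputation P g ∧ P.size ≤ t n m)`

## Assembly
Inside `closes` (glue.lean, 0 sorry, ~25 lines): (i) PerNotTame from SensitiveHardPoly and
QuantHrubesPer — given a p-size fan-in-two circuit P
for per_n with absEval P ≤ 2^(n^C+C), Hrubeš's simulation at ε = 2^-(n^C+C) (ε·absEval P ≤ 1) makes
U_n + ε per_n monotone-easy in size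
t n (s n), contradicting SensitiveHardPoly at budget C; (ii) S from PerNotTame and TamePer through
per ∉ VP_ℝ ⟺ S
(Summit.ValiantsHypothesis.StrongHypotheses.perNotPComputableReal_iff: scalar extension +
Hrubeš–Yehudayoff realification + Bürgisser 2000
Rem. 2.11). Binders consumed: SensitiveHardPoly, TamePer, QuantHrubesPer (cone 3: 2 cruxes + 1
provable-now support); PerNotTame is the glue
node the proof passes through; SensitiveHardAtOne is the rung beneath SensitiveHardPoly (not in the
cone by construction — a rung never implies
its crux). Converse S ⟹ every piece: lens theorems sensitiveHardPoly_of_summit, tamePer_of_summit,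
perNotTame_of_summit (kernel, file sha above).

Rationale: WHY THIS LINE. Workshop doctrine: Summit ⟸ A ∧ B ∧ … with every piece strictly WEAKER than S
(implied by S, not known to imply it, not barrier-excluded), every
piece NECESSARY, difficulty distributed, ≥ 1 piece attackable now. The lens dials Hrubeš's loss
parameter: at rate 2^-(ηn) the lower-bound side is
a theorem in print (ChattopadhyayDattaMukhopadhyay2021, ChattopadhyayDattaGhosalMukhopadhyay2022)
and the transfer side is REFUTED class-wide
(tree Literature.Barriers.ValiantsHypothesis.MonotoneGap, not_sensitiveTransfer); at rate
2^-(2^poly) the transfer side is ≈ a theorem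
(BasuPollackRoy2006 Thm 13.15) and the bound ≡ S; at the single-exponential rate 2^-(n^C+C) of this
node both halves are open, both necessary,
neither known to give S — and the lower-bound half is reachable from PROVED monotone technology
(JerrumSnir1982, Hrubes2020 Thm 1). Trade vs the
folklore split [W-ws := VBP ≠ VNP, B_f := (VP=VNP → VNP ⊆ VBP)]
(Cruxes/ClassTransfer/DecompositionCensus §3): PerNotTame is INCOMPARABLE with W-ws
(tame circuits vs ABPs); bought = a lower-bound half fed by monotone bounds plus a residual with a
proved doubly-exponential floor; not bought = any
evidence for TamePer beyond vacuity (declared IDEA-NEEDED; KoiranPerifel2011 Rem. 4 open even for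
per). Imported: ε-sensitive monotone computation
(Hrubes2020), monotone arithmetic lower bounds (JerrumSnir1982, Srinivasan2022), real algebraic
geometry bit-size bounds (BasuPollackRoy2006),
constant-free Valiant theory (Burgisser2000, KoiranPerifel2011).

RANKED CRUXES. #2 SensitiveHardPoly (crux) — PIECE A — at EVERY single-exponential rate the
perturbed permanent is monotone-hard infinitely often: for all C and every p-bounded s there is an n
such that no ε with 2^-(n^C+C) ≤ ε ≤ 1 makes U_n + ε·per_n (U_n = (1 + Σ_ij x_ij)^n over ℝ)
computable by a Jerrum–Snir monotone computation (plain fan-in-two circuit over ℝ≥0, tree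
IsMonotoneComputation) of size ≤ s n. TAG WEAKER(evidence: S ⟹ A kernel, lens
sensitiveHardPoly_of_summit via L(U_n) ≤ n(n²+2); A ⟹ S open — the gap is exactly TameTransfer;
critic decomp-val-crit-1-g0 CLEARED 2026-08-29T17:58:46Z = CRITIC-LEDGER.md row 3 (probe file
HOME/critic/L6_TameSensitivity_v1_probe.lean
sha256=8a732ff073fb3381fce3239b1f47ae5edd44308238df06397a707025e1d8be4f)). NECESSARY (i.o. form,
critic quantifier check ✓). LEAF: ATTACKABLE — typed rungs SensitiveHardAt C (strength increasing in
C, critic_sensitiveHardAt_succ) with bottom rung = support item SensitiveHardAtOne (Hrubeš 2020 §6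
Open Problem 1 in (1+Σx)^n form); techniques: ε-sensitive corruption / rectangle-discrepancy bounds
(ChattopadhyayDattaMukhopadhyay2021 Thm 1.2, ChattopadhyayDattaGhosalMukhopadhyay2022 §1).
INSTRUMENTABLE: NULL (n ≤ 3 exhaustive monotone size uninformative; critic). [difficulty:
open-problem] (why it might fail: U_n has full support, so support-based monotone methods are blind
(Hrubes2020 p.6); a per-rectangle anti-concentration bound at rate 2^-poly is not in print, and
Hrubeš Thm 1 shows U_n + ε per_n IS monotone-easy for tiny ε.) [Hrubes2020,
ChattopadhyayDattaMukhopadhyay2021, ChattopadhyayDattaGhosalMukhopadhyay2022, JerrumSnir1982,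
Srinivasan2022]
#3 TamePer (crux) — PIECE B1 — collapse ⇒ numerical tameness of the permanent: if per is
p-computable over ℝ then it is p-computable by fan-in-two real circuits whose absolute-value
evaluation at the all-ones point (Hrubeš radius) is ≤ 2^(n^C+C) for some C. TAG
DECLARED-RESIDUAL(PerNotTame): TamePer ⟺ (PerNotTame → S) (writer tamePer_iff_residual, lens
tamePer_iff_residual, critic row 3); formally WEAKER = vacuous under S (lens tamePer_of_summit); NOT
COSTUME (PerNotTame open; it implies per ∉ sign-constant p-size circuits). LEAF: IDEA-NEEDED
(declared) — content lines u1 Theses.NumTame.MagnitudeNF (open, universal magnitude normal form), u2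
BasuPollackRoy2006 Thm 13.15 doubly-exponential floor (locates the residual, not progress), u3
Bürgisser 2009 Thm 2.10 VNP⁰ normal forms; alternative content line TamePer ⟸ SmallConstPer ∧
TameGrowth (lens tamePer_of_smallConst_growth; unbalanced per critic). STAFF LAST or not at all
(critic w2); residual declared for the tribunal (`residual: TamePer`). [difficulty: open-problem]
(why it might fail: no mechanism turns VP = VNP into small magnitudes: constant elimination gives
algebraic constants of height 2^2^poly for a fixed skeleton (arithmetic Bézout); KoiranPerifel2011
Rem. 4 is open even for per.) [KoiranPerifel2011, BasuPollackRoy2006, Burgisser2000, Hrubes2020]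
#9 QuantHrubesPer (support) — PIECE B2 — Hrubeš's Theorem 1 for per_n with the explicit threshold ε₀
≥ 1/absEval: there is a size overhead t, p-boundedness-preserving, such that every fan-in-two real
circuit P of size ≤ m computing per_n yields, for every 0 < ε ≤ 1 with ε·absEval P ≤ 1, a monotone
computation of U_n + ε per_n of size ≤ t n m. TAG WEAKER (a theorem-in-waiting: Hrubes2020 §4 proof
of Thm 1 — ±-splitting gives (P₊+P₋)(𝟙) = absEval P, homogeneous-majorant induction, size O(m n² +
n² log n); the tree's Hrubes2020_sensitive_holds is the ∃ε₀ form; threshold verified independently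
by the critic, row 3). Load-bearing binder of `closes` (feeds SensitiveHardPoly ⟹ PerNotTame). LEAF:
ATTACKABLE = PROVABLE-NOW from HrubesSensitiveMonotoneProofs.lean. [difficulty: provable-now]
[Hrubes2020]
#9 PerNotTame (support) — NODE T (internal AND-node of the tree, glue node of `closes`): the
permanent has no polynomial-size TAME real circuits at any magnitude budget — for every C and
p-bounded s there is an n such that every fan-in-two real circuit of size ≤ s n computing per_n has
absolute-value evaluation > 2^(n^C+C). ROOT: S ⟺ PerNotTame ∧ TamePer (summit_iff_tame_split);
ATTACK: PerNotTame ⟸ SensitiveHardPoly ∧ QuantHrubesPer (perNotTame_of_sensitive, realised inside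
`closes`). TAG WEAKER (S ⟹ it, lens perNotTame_of_summit; converse = TamePer open); critic remark:
budgets C ≤ 1 are trivial (absEval P ≥ |P(𝟙)| = n! > 2^(n+1) for n ≥ 5), content starts at C = 2.
Restricted-model lower bound; monotone circuits are its cancellation-free corner. [difficulty:
open-problem] [Hrubes2020, JerrumSnir1982]
#9 SensitiveHardAtOne (support) — RUNG A₁ (bottom rung of SensitiveHardPoly, ε = 1; the BC5
first-rung / witness target of the deciding crux, NOT a binder of `closes`): (1 + Σ_ij x_ij)^n +
per_n is not monotone p-computable — for every p-bounded s some n admits no monotone computation of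
U_n + per_n of size ≤ s n. This is the (1+Σx)^n-form of Hrubeš 2020 §6 Open Problem 1 ("How about
Π_i(Σ_j x_ij) + perm_n?", verified p.27 [corpus:paper:galaxy-pdf-8480837716326541740]). TAG WEAKER
(SensitiveHardPoly ⟹ SensitiveHardAt 0 ⟹ it, writer sensitiveHardAtOne_of_sensitiveHardPoly; S ⟹
it); LEAF: ATTACKABLE NOW (i.o. form; outside S's known regime: no monotone lower bound for a
full-support perturbation of per is in print; CDM21 Thm 1.2 is MOD3∘XOR, CDGM22 is the spanning-tree
polynomial — per untouched, critic-verified). [difficulty: L] [Hrubes2020,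
ChattopadhyayDattaMukhopadhyay2021, Srinivasan2022]

TWO-LAYER PLAN. Foreseen glued splits (not filed as decompositions of record): TamePer ⟸
SmallConstPer ∧ TameGrowth (lens tamePer_of_smallConst_growth;
SmallConstPer = collapse ⇒ per has p-size fan-in-two circuits with constants of modulus ≤ 2^(n^C+C)
and formal degrees ≤ n^C+C — the
per-specific conditional shadow of Theses.NumTame.MagnitudeNF; TameGrowth = the provable-now growth
lemma absEval ≤ 2^((R+1)·D·(size+2)));
critic: unbalanced (SmallConstPer is the residual of the WEAKER bound PerNotSmallConst), so it stays
a content line. SensitiveHardPoly ⟸ ∀ C,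
SensitiveHardAt C is definitional (rung ladder, not a split).

KILL CRITERIA. A monotone p-size computation of U_n + per_n for all large n refutes
SensitiveHardAtOne and with it SensitiveHardAt 0 (the ladder then starts
higher, the crux survives); a p-size monotone computation of U_n + ε_n per_n at some ε_n ≥
2^-(n^C+C) for every n and every C refutes
SensitiveHardPoly and closes the route refuted. A proof that p-size real circuits for per_n force
absEval > 2^poly unconditionally would prove
PerNotTame outright (the attack node becomes moot, the route lives on TamePer = residual only ⇒
re-examined by the critic as a costume risk).
QuantHrubesPer failing as typed (threshold ε·absEval ≤ 1 too generous) is repaired by the print's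
gate-sum radius — a restatement, not a kill.

NOT DECOMPOSED YET. TamePer (declared residual, IDEA-NEEDED: no split of record); the rungs
SensitiveHardAt C for C ≥ 1 are lines under SensitiveHardPoly, not
items; the frame MonotoneLift / PerMonotoneHard and the alternative content line SmallConstPer ∧
TameGrowth are records in the lens file and in
HOME/TREE.md, not items (this gate has no `aside` item kind; critic w2 acknowledged on the bus).

CHEAPEST FALSIFIER. Literature lookup for a monotone upper bound on (1+Σx)^n + per_n or on U_n +
2^-poly·per_n (would kill the bottom rungs): lens + critic searches
2026-08-29 — galaxy "ε-sensitive|epsilon-sensitive|sensitive monotone" --star all (Hrubeš TR19-034,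
CDM ECCC TR20-166 only), corpus fts+vec "tame
circuit", "radius" + "VP = VNP": no hits; Hrubes2020 Thm 1 gives easiness only below ε₀(P). Kernel:
lens file rc 0 / 0 sorry / 0 warnings (critic
re-check); writer's inlined re-typing ts/Sketch.lean rc 0 (closes, tamePer_iff_residual,
perNotTame_of_sensitive, summit_iff_tame_split,
sensitiveHardAtOne_of_sensitiveHardPoly).

NUMBERS. Rates of the dial: 2^-(ηn) (A proved in print / B refuted), 2^-(n^C+C) (this node: both
open), 2^-(2^poly) (B ≈ theorem, A ≡ S). Jerrum–Snir:
every monotone computation of per_n has ≥ n(2^(n-1) − 1) product gates. PerNotTame budgets C ≤ 1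
trivial (n! > 2^(n+1), n ≥ 5). Items at open: 6
(2 cruxes, 3 support of which 1 load-bearing, 1 assembly); cone of closes = 3 binders. kit: 0 core-h
(census seat budget untouched by this node).

DEFINITION REQUESTS. None filed: the lens's local vocabulary (U_n, MonoEasy, rate, absEval) is
INLINED into the item statements over existing declarations
(ArithCircuit, ArithCircuit.mapConsts, ArithCircuit.eval/size/IsFanInTwo/Computes, perPoly,
IsPBounded, IsPComputable,
Literature.Barriers.ValiantsHypothesis.IsMonotoneComputation, NNReal.toRealHom); a later definition
item `absEval` in
Summits/ValiantsHypothesis/ValiantsHypothesis/Theorems would shorten them (optional).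

Novelty: Searches (lens decomp-val-lens-6 and critic, 2026-08-29, recorded in
HOME/decomp-val-lens-6/TameSensitivity.lean docstring and critic row 3): lit galaxy search
"ε-sensitive|epsilon-sensitive|sensitive monotone" --star all → Hrubeš TR19-034, CDM ECCC TR20-166;
"VP0|constant-free|tau-conjecture" --star pdf → noise; corpus fts+vec "tame circuit", "radius"+"VP =
VNP" → no hits; Hrubeš OP1 verified p.27 [corpus:paper:galaxy-pdf-8480837716326541740]; tree: routes
CirculantFourier / NumTame / MonotoneRestoration / DivisionGap compared (deltas in the lens
docstring) — none carries a budget-indexed sensitivity family or a collapse ⇒ magnitude statement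
for per.
Nearest prior art found: Hrubes2020 (Thm 1 and §6 OP1), ChattopadhyayDattaMukhopadhyay2021 (Thm
1.2), ChattopadhyayDattaGhosalMukhopadhyay2022 (§1; tree MonotoneGap.not_sensitiveTransfer),
JerrumSnir1982 §4.3, route NumTame (MagnitudeNF).
Delta: the loss parameter of Hrubeš's ε-sensitive bridge (log of the radius absEval) is used as the
DIAL of an exact AND-split of VP≠VNP — lower bound against tame circuits fed by monotone technology
∧ a declared residual with a proved doubly-exponential floor — a node absent from the four
monotone/magnitude routes of the summit and from the searched literature.
Claimed grade: new-combination  [refs: paper:galaxy-pdf-8480837716326541740, Hrubes2020, ChattopadhyayDattaMukhopadhyay2021, ChattopadhyayDattaGhosalMukhopadhyay2022, JerrumSnir1982]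

Barriers (technique_class: decomposition, monotone lifting, epsilon-sensitive): - technique_class: decomposition, monotone lifting, epsilon-sensitive
- Literature.Barriers.ValiantsHypothesis.MonotoneGap: SensitiveHardPoly is a monotone LOWER BOUND
for one per-specific perturbed family, not a transfer — outside; the refuted statement is the
CLASS-wide SensitiveTransfer at rate 2^-(ηN) (MonotoneGap.lean:474, not_sensitiveTransfer via CDGM's
ST ∈ VP); TamePer / TameTransfer are per-only, conditional on the collapse and at rate 2^-(n^C+C) ∃C
— none of the barrier theorem's hypotheses (class-wide, linear-exponential rate) is met.
- Literature.Barriers.ValiantsHypothesis.AlgebraicNaturalProofs: monotone / ε-sensitive lower bounds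
are not rank-type natural properties useful against VP (they hold against monotone computations
only); the node applies no largeness/constructivity-type measure to VP — outside; the bet is that
the lift (TamePer) is where VP-strength enters, and it is declared residual.
- Literature.Barriers.ValiantsHypothesis.PartialDerivativesDetPerm: not in play — no piece bounds a
flattening / partial-derivative rank profile or separates per from det; SensitiveHardPoly is a
monotone (cancellation-free) size lower bound for U_n + ε per_n and PerNotTame a magnitude bound on
real circuits, neither a function of flattening ranks — outside the barrier's class.
- Literature.Barriers.ValiantsHypothesis.TauRealZeros: not in play — no piece counts real zeros of
univariate straight-line programs or invokes a τ-type zero bound; the only real-analytic quantit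

History (route lifecycle, newest last):
- 2026-08-30T00:49:07Z · rev 11: informal re-worded for PerNotNcVP, NcLift, SmToNcPer (planner-decomp-val-writer-1-g2-0)
- 2026-08-30T23:56:16Z · RESIDUAL declared: TamePer (stmt-ValiantsHypothesis-23514) — summit-strength until shown otherwise: D-0170 flag now live (gate #11): TamePer = the declared residual R1 of record of the cycle-1 Theses file (TREE N1; criti (planner-decomp-val-writer-1-g5-0)

sub-problem: ValiantsHypothesis · status: draft · opened planner-decomp-val-writer-1-g0-0 2026-08-29T18:07:34Z · rev 13 · ledger route-ValiantsHypothesis-DecompCycle1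
GENERATED by the gate from the ledger (D-0016/17). Provers cite these decls: `theorem foo : Summit.ValiantsHypothesis.ValiantsHypothesis.Theses.DecompCycle1.<Decl> := …` in Summits/ValiantsHypothesis/ValiantsHypothesis/Theorems/<Name>.lean.
-/

namespace Summit.ValiantsHypothesis.ValiantsHypothesis.Theses.DecompCycle1

open scoped BigOperators Topology Manifold Classical MeasureTheory ProbabilityTheory Matrix InnerProductSpace ComplexConjugate ContinuousMap
open Filter Set Function TopologicalSpace MeasureTheory

attribute [summit_statement] _root_.ValiantsHypothesis

open Literature.PNP

/-- item stmt-ValiantsHypothesis-23513 · crux · rank 2 · open · by planner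
why it might fail: U_n has full support, so support-based monotone methods are blind (Hrubes2020 p.6); a per-rectangle anti-concentration bound at rate 2^-poly is not in print, and Hrubeš Thm 1 shows U_n + ε per_n IS monotone-easy for tiny ε.
sources: Hrubes2020, ChattopadhyayDattaMukhopadhyay2021, ChattopadhyayDattaGhosalMukhopadhyay2022, JerrumSnir1982, Srinivasan2022
[crux] PIECE A — at EVERY single-exponential rate the perturbed permanent is monotone-hard
infinitely often: for all C and every p-bounded s there is an n such that no ε with 2^-(n^C+C) ≤ ε ≤
1 makes U_n + ε·per_n (U_n = (1 + Σ_ij x_ij)^n over ℝ) computable by a Jerrum–Snir monotone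
computation (plain fan-in-two circuit over ℝ≥0, tree IsMonotoneComputation) of size ≤ s n. TAG
WEAKER(evidence: S ⟹ A kernel, lens sensitiveHardPoly_of_summit via L(U_n) ≤ n(n²+2); A ⟹ S open —
the gap is exactly TameTransfer; critic decomp-val-crit-1-g0 CLEARED 2026-08-29T17:58:46Z =
CRITIC-LEDGER.md row 3 (probe file HOME/critic/L6_TameSensitivity_v1_probe.lean
sha256=8a732ff073fb3381fce3239b1f47ae5edd44308238df06397a707025e1d8be4f)). NECESSARY (i.o. form,
critic quantifier check ✓). LEAF: ATTACKABLE — typed rungs SensitiveHardAt C (strength increasing in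
C, critic_sensitiveHardAt_succ) with bottom rung = support item SensitiveHardAtOne (Hrubeš 2020 §6
Open Problem 1 in (1+Σx)^n form); techniques: ε-sensitive corruption / rectangle-discrepancy bounds
(ChattopadhyayDattaMukhopadhyay2021 Thm 1.2, ChattopadhyayDattaGhosalMukhopadhyay2022 §1).
INSTRUMENTABLE: NULL (n ≤ 3 exhaustive monotone size uninforma -/
@[route_item "route-ValiantsHypothesis-DecompCycle1", crux (bottleneck := work) (source := "ledger D-0171 leaf tag ATTACKABLE on stmt-ValiantsHypothesis-23513, 2026-09-01")]
def SensitiveHardPoly : Prop :=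
  ∀ (C : ℕ) (s : ℕ → ℕ), Literature.Computability.AlgebraicComplexity.IsPBounded s → ∃ n : ℕ, ∀ ε : ℝ, ((2 : ℝ) ^ (n ^ C + C))⁻¹ ≤ ε → ε ≤ 1 → ¬ (∃ (g : MvPolynomial (Fin n × Fin n) NNReal) (P : Literature.Computability.AlgebraicComplexity.ArithCircuit NNReal (Fin n × Fin n)), MvPolynomial.map NNReal.toRealHom g = (1 + ∑ ij : Fin n × Fin n, MvPolynomial.X ij) ^ n + MvPolynomial.C ε * Literature.Computability.AlgebraicComplexity.perPoly (Fin n) ℝ ∧ Literature.Barriers.ValiantsHypothesis.IsMonotoneComputation P g ∧ P.size ≤ s n)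

/-- item stmt-ValiantsHypothesis-23514 · crux · RESIDUAL (gen 0; summit-strength until shown otherwise, D-0170) · rank 3 · SPLIT (gen 1) into PerNotSmVP, TameOrSmLift + glue TamePerGlue · direct attempts still welcome (low priority) · by planner
why it might fail: no mechanism turns VP = VNP into small magnitudes: constant elimination gives algebraic constants of height 2^2^poly for a fixed skeleton (arithmetic Bézout); KoiranPerifel2011 Rem. 4 is open even for per.
sources: KoiranPerifel2011, BasuPollackRoy2006, Burgisser2000, Hrubes2020
[crux] PIECE B1 — collapse ⇒ numerical tameness of the permanent: if per is p-computable over ℝ then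
it is p-computable by fan-in-two real circuits whose absolute-value evaluation at the all-ones point
(Hrubeš radius) is ≤ 2^(n^C+C) for some C. TAG DECLARED-RESIDUAL(PerNotTame): TamePer ⟺ (PerNotTame
→ S) (writer tamePer_iff_residual, lens tamePer_iff_residual, critic row 3); formally WEAKER =
vacuous under S (lens tamePer_of_summit); NOT COSTUME (PerNotTame open; it implies per ∉
sign-constant p-size circuits). LEAF: IDEA-NEEDED (declared) — content lines u1
Theses.NumTame.MagnitudeNF (open, universal magnitude normal form), u2 BasuPollackRoy2006 Thm 13.15
doubly-exponential floor (locates the residual, not progress), u3 Bürgisser 2009 Thm 2.10 VNP⁰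
normal forms; alternative content line TamePer ⟸ SmallConstPer ∧ TameGrowth (lens
tamePer_of_smallConst_growth; unbalanced per critic). STAFF LAST or not at all (critic w2); residual
declared for the tribunal (`residual: TamePer`). [difficulty: open-problem] -/
@[route_item "route-ValiantsHypothesis-DecompCycle1", crux]
def TamePer : Prop :=
  Literature.Computability.AlgebraicComplexity.IsPComputable (fun n => Literature.Computability.AlgebraicComplexity.perPoly (Fin n) ℝ) → ∃ (C : ℕ) (s : ℕ → ℕ), Literature.Computability.AlgebraicComplexity.IsPBounded s ∧ ∀ n : ℕ, ∃ P : Literature.Computability.AlgebraicComplexity.ArithCircuit ℝ (Fin n × Fin n), P.IsFanInTwo ∧ P.Computes (Literature.Computability.AlgebraicComplexity.perPoly (Fin n) ℝ) ∧ P.size ≤ s n ∧ MvPolynomial.eval (fun _ => (1 : ℝ)) (Literature.Computability.AlgebraicComplexity.ArithCircuit.mapConsts (fun c : ℝ => |c|) P).eval ≤ (2 : ℝ) ^ (n ^ C + C)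

-- parent: TamePer · child (gen 1)
/--     item stmt-ValiantsHypothesis-23661 · crux · rank 301 · open
    parent: TamePer · by planner
    why it might fail: it is true if VP≠VNP (kernel); as a TARGET it is blocked: best sm circuit bounds are n^{4/3} (RSY08) / n² for sm ABPs (AKV20), rank measures capped at n³ by the RY08 full-rank polynomial (tree FullRankMultilinear).
    sources: doi:10.1137/070707932, arXiv:1708.02037, doi:10.1007/s00037-008-0254-0, arXiv:2604.00746, arXiv:1902.07063
[crux] A_ml — per ∉ smVP_ℂ infinitely often: for every exponent c there is an n such that every
fan-in-two syntactically multilinear circuit over ℂ computing per_n has size > n^c + c. [difficulty: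
open-problem] -/
@[route_item "route-ValiantsHypothesis-DecompCycle1", crux]
def PerNotSmVP : Prop :=
  ∀ c : ℕ, ∃ n : ℕ, ∀ P : Literature.Computability.AlgebraicComplexity.ArithCircuit ℂ (Fin n × Fin n), P.IsFanInTwo → Literature.Computability.AlgebraicComplexity.IsSyntacticallyMultilinear P → P.Computes (Literature.Computability.AlgebraicComplexity.perPoly (Fin n) ℂ) → n ^ c + c < P.size

-- parent: TamePer · child (gen 1)
/--     item stmt-ValiantsHypothesis-23662 · crux · rank 302 · open
    parent: TamePer · by planner
    why it might fail: vacuously true under VP≠VNP; its informal content can fail on both branches: large constants may genuinely help per under collapse (Koiran–Perifel 2011) and det may lie outside smVP (no multilinearisation below 2^{O(n)} is known).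
    sources: Burgisser2000, doi:10.1007/BF01294256, doi:10.1561/0400000039, arXiv:1902.07063
[crux] B_v2 (declared residual of PerNotTame ∧ PerNotSmVP) — if VP_ℂ = VNP_ℂ then EITHER per is
p-computable over ℝ by fan-in-two circuits of p-bounded size with Hrubeš radius (abs-value circuit
at the all-ones point) ≤ 2^(n^C+C), OR per ∈ smVP_ℂ (for some c and all n a fan-in-two sm circuit of
size ≤ n^c + c computes per_n). [difficulty: open-problem] -/
@[route_item "route-ValiantsHypothesis-DecompCycle1", crux]
def TameOrSmLift : Prop :=
  Literature.Computability.AlgebraicComplexity.VP ℂ = Literature.Computability.AlgebraicComplexity.VNP ℂ → (∃ (C : ℕ) (s : ℕ → ℕ), Literature.Computability.AlgebraicComplexity.IsPBounded s ∧ ∀ n : ℕ, ∃ P : Literature.Computability.AlgebraicComplexity.ArithCircuit ℝ (Fin n × Fin n), P.IsFanInTwo ∧ P.Computes (Literature.Computability.AlgebraicComplexity.perPoly (Fin n) ℝ) ∧ P.size ≤ s n ∧ MvPolynomial.eval (fun _ => (1 : ℝ)) (Literature.Computability.AlgebraicComplexity.ArithCircuit.mapConsts (fun c : ℝ => |c|)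 P).eval ≤ (2 : ℝ) ^ (n ^ C + C)) ∨ (∃ c : ℕ, ∀ n : ℕ, ∃ P : Literature.Computability.AlgebraicComplexity.ArithCircuit ℂ (Fin n × Fin n), P.IsFanInTwo ∧ Literature.Computability.AlgebraicComplexity.IsSyntacticallyMultilinear P ∧ P.Computes (Literature.Computability.AlgebraicComplexity.perPoly (Fin n) ℂ) ∧ P.size ≤ n ^ c + c)

-- parent: TamePer · glue (gen 1)
/--     item stmt-ValiantsHypothesis-23663 · support · rank 303 · closed · proved by Summit.ValiantsHypothesis.ValiantsHypothesis.Theorems.DecompCycle1TamePerSplit.tamePerGlue_holds (planner)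
    parent: TamePer · GLUE: children ⟹ parent · by planner
PerNotSmVP → TameOrSmLift → TamePer: by cases on the lifting disjunction — the sm branch of
TameOrSmLift is literally ¬PerNotSmVP (same quantifier form), the tame branch is the consequent of
TamePer verbatim; real→complex p-computability of per by extension of scalars
(ArithCircuit.complexity_map_le, map_perPoly, isPComputable_perPoly_complex_iff). PROVED in
HOME/decomp-val-lens-6/split_glue.lean (tamePer_of_split, kernel, 0 sorry) — to be landed as
Theorems/DecompCycle1TamePerSplit.lean. -/
@[route_item "route-ValiantsHypothesis-DecompCycle1"]
def TamePerGlue : Prop :=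
  PerNotSmVP → TameOrSmLift → TamePer

-- `TamePerGlue` holds: proved by `Summit.ValiantsHypothesis.ValiantsHypothesis.Theorems.DecompCycle1TamePerSplit.tamePerGlue_holds` (its module imports this route file, so no `_holds` link can be stated here).

/-- item stmt-ValiantsHypothesis-23446 · aside · rank 9 · open · by planner
[aside · A_nc · lens-6 g4 CommutativityDial, critic CLEARED 22:51:54Z as a typed SIBLING DIAL POINT;
placement record, NEVER a binder of closes] PerNotNcVP: the ORDERED permanent has no polynomial-size
fan-in-two NONCOMMUTATIVE circuits, infinitely often. TYPED (writer g2 2026-08-30T00:45Z, after the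
lens-6 g5 hoist p753208 = route-independent Theorems/NcSemantics.lean, commit 2fa1ab66e85c; no
import cycle): the signature is the body of
Summit.ValiantsHypothesis.ValiantsHypothesis.Theorems.NcSemantics.PerNotNcVP INLINED over
NcSemantics.ncEval / NcSemantics.ncPerPoly (one syntax, two semantics: ncEval re-reads the tree's
ArithCircuit in the free algebra, comm ∘ ncEval = eval, NcSemantics.comm_ncEval) — definitionally
the tree decl (Iff.rfl, writer probe nc/asides_probe.lean rc 0); it is NOT referenced by name
because NcSemantics.PerNotNcVP carries @[conjecture] (a by-name leaf would flag the route
undeclared-conjecture). PLACEMENT EDGES (kernel): S ⟹ PerNotNcVP (NcSemantics.perNotNcVP_of_vh;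
CommutativityDial.perNotNcVP_of_vh p748700); PerNotSmVP (23661) ⟹ PerNotNcVP
(perNotNcVP_of_perNotSmVP p749138 via HWY10 Thm F.1 formalised exists_sm_of_nc); exact residual
NcLift (NcSemantics. -/
@[route_item "route-ValiantsHypothesis-DecompCycle1", crux]
def PerNotNcVP : Prop :=
  ∀ c : ℕ, ∃ n : ℕ, ∀ P : Literature.Computability.AlgebraicComplexity.ArithCircuit ℂ (Fin n × Fin n), P.IsFanInTwo → Summit.ValiantsHypothesis.ValiantsHypothesis.Theorems.NcSemantics.ncEval P = Summit.ValiantsHypothesis.ValiantsHypothesis.Theorems.NcSemantics.ncPerPoly n → n ^ c + c < P.size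

/-- item stmt-ValiantsHypothesis-23447 · aside · rank 9 · open · by planner
[aside · B_nc · lens-6 g4 CommutativityDial, critic CLEARED 22:51:54Z; DECLARED-RESIDUAL of A_nc,
placement record, NEVER a binder of closes] NcLift: if VP_ℂ = VNP_ℂ then the ordered permanent has
fan-in-two noncommutative circuits of polynomial size (a.e.). TYPED (writer g2 2026-08-30T00:45Z,
after the lens-6 g5 hoist p753208): the signature is the body of
Summit.ValiantsHypothesis.ValiantsHypothesis.Theorems.NcSemantics.NcLift INLINED over
NcSemantics.ncEval / NcSemantics.ncPerPoly — definitionally the tree decl (Iff.rfl, writer probe rc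
0); not referenced by name because NcSemantics.NcLift carries @[conjecture]. PLACEMENT EDGES
(kernel): NcLift ⟺ (PerNotNcVP → S) (NcSemantics.ncLift_iff_residual), S ⟺ PerNotNcVP ∧ NcLift
(NcSemantics.summit_iff_split; the gate's summit_equivalent flag = conjunct reading conditional on
23446), S ⟹ NcLift vacuously (NcSemantics.ncLift_of_vh), NcLift ⟹ TameOrSmLift (23662) and indeed
its sm disjunct (tameOrSmLift_of_ncLift, smLiftPer_of_ncLift p749138) — STRONGER than the gen-2
residual (zero-sum slide declared, LESSON 6). TAGS: DECLARED-RESIDUAL · WEAKER (vacuous under S) ·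
EXACT · IDEA-NEEDED (no mechanism re-orders a commutative circuit for per -/
@[route_item "route-ValiantsHypothesis-DecompCycle1", crux]
def NcLift : Prop :=
  Literature.Computability.AlgebraicComplexity.VP ℂ = Literature.Computability.AlgebraicComplexity.VNP ℂ → ∃ c : ℕ, ∀ n : ℕ, ∃ P : Literature.Computability.AlgebraicComplexity.ArithCircuit ℂ (Fin n × Fin n), P.IsFanInTwo ∧ Summit.ValiantsHypothesis.ValiantsHypothesis.Theorems.NcSemantics.ncEval P = Summit.ValiantsHypothesis.ValiantsHypothesis.Theorems.NcSemantics.ncPerPoly n ∧ P.size ≤ n ^ c + c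

/-- item stmt-ValiantsHypothesis-23448 · aside · rank 9 · open · by planner
[aside · arrow piece of Reading B under 23661 · lens-6 g4 CommutativityDialSplit (p749302), critic
23:07:41Z / 23:09:14Z; placement record, NEVER a binder of closes; the --split of 23661 itself is
refused by the two-layer rule (23661 is a child of TamePer)] SmToNcPer := PerNotNcVP → PerNotSmVP
(23661): the per-specific set-multilinear → ordered/noncommutative converse simulation. TYPED
(writer g2 2026-08-30T00:45Z): signature `PerNotNcVP → PerNotSmVP` over the sibling route decls
23446 / 23661 (short names, as the glue item TamePerGlue); CommutativityDialSplit.SmToNcPer is the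
same arrow over the CommutativityDial copies. LABEL (critic's condition, verbatim):
DECLARED-RESIDUAL (of the sub-node 23661: the content of {A_nc, A_nc → 23661} is the arrow — LESSON
3) · IDEA-NEEDED, concrete FACE: the per-specific set-multilinear → ordered/nc simulation fails
exactly at INTERLEAVED column blocks ({1,3}×{2,4}-type products; set-multilinear ≠ interval-ordered
= the any-order-vs-fixed-order ROABP gap), HWY10 p8 'not known in the commutative case'. KERNEL:
PerNotSmVP ⟺ PerNotNcVP ∧ SmToNcPer (perNotSmVP_iff_ncSplit), S ⟹ PerNotSmVP ⟹ SmToNcPer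
(smToNcPer_of_vh via perNotSmVP_of_vh; writer prob -/
@[route_item "route-ValiantsHypothesis-DecompCycle1", crux]
def SmToNcPer : Prop :=
  PerNotNcVP → PerNotSmVP

/-- item stmt-ValiantsHypothesis-23515 · support · rank 9 · closed · proved by Summit.ValiantsHypothesis.ValiantsHypothesis.Theorems.TameSensitivityQuantHrubes.quantHrubesPer (planner) · by planner
sources: Hrubes2020
[support] PIECE B2 — Hrubeš's Theorem 1 for per_n with the explicit threshold ε₀ ≥ 1/absEval: there
is a size overhead t, p-boundedness-preserving, such that every fan-in-two real circuit P of size ≤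
m computing per_n yields, for every 0 < ε ≤ 1 with ε·absEval P ≤ 1, a monotone computation of U_n +
ε per_n of size ≤ t n m. TAG WEAKER (a theorem-in-waiting: Hrubes2020 §4 proof of Thm 1 —
±-splitting gives (P₊+P₋)(𝟙) = absEval P, homogeneous-majorant induction, size O(m n² + n² log n);
the tree's Hrubes2020_sensitive_holds is the ∃ε₀ form; threshold verified independently by the
critic, row 3). Load-bearing binder of `closes` (feeds SensitiveHardPoly ⟹ PerNotTame). LEAF:
ATTACKABLE = PROVABLE-NOW from HrubesSensitiveMonotoneProofs.lean. [difficulty: provable-now] -/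
@[route_item "route-ValiantsHypothesis-DecompCycle1", crux]
def QuantHrubesPer : Prop :=
  ∃ t : ℕ → ℕ → ℕ, (∀ s : ℕ → ℕ, Literature.Computability.AlgebraicComplexity.IsPBounded s → Literature.Computability.AlgebraicComplexity.IsPBounded fun n => t n (s n)) ∧ ∀ (n : ℕ) (P : Literature.Computability.AlgebraicComplexity.ArithCircuit ℝ (Fin n × Fin n)) (m : ℕ), P.IsFanInTwo → P.Computes (Literature.Computability.AlgebraicComplexity.perPoly (Fin n) ℝ) → P.size ≤ m → ∀ ε : ℝ, 0 < ε → ε ≤ 1 → ε * MvPolynomial.eval (fun _ => (1 : ℝ)) (Literature.Computability.AlgebraicComplexity.ArithCircuit.mapConsts (fun c : ℝ => |c|) P).eval ≤ 1 → ∃ (g : MvPolynomial (Fin n × Fin n) NNReal) (P : Literature.Computability.AlgebraicComplexity.ArithCircuit NNReal (Fin n × Fin n)), MvPolynomial.map NNReal.toRealHom g = (1 + ∑ ij : Fin n × Fin n, MvPolynomial.X ij) ^ n + MvPolynomial.C ε * Literature.Computability.AlgebraicComplexity.perPoly (Fin n) ℝ ∧ Literature.Barriers.ValiantsHypothesis.IsMonotoneComputation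 P g ∧ P.size ≤ t n m

/-- `QuantHrubesPer` holds: proved by `Summit.ValiantsHypothesis.ValiantsHypothesis.Theorems.TameSensitivityQuantHrubes.quantHrubesPer`. -/
theorem QuantHrubesPer_holds : QuantHrubesPer := _root_.Summit.ValiantsHypothesis.ValiantsHypothesis.Theorems.TameSensitivityQuantHrubes.quantHrubesPer

/-- item stmt-ValiantsHypothesis-23516 · aside · rank 9 · open · by planner
sources: Hrubes2020, JerrumSnir1982
[support] NODE T (internal AND-node of the tree, glue node of `closes`): the permanent has no
polynomial-size TAME real circuits at any magnitude budget — for every C and p-bounded s there is an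
n such that every fan-in-two real circuit of size ≤ s n computing per_n has absolute-value
evaluation > 2^(n^C+C). ROOT: S ⟺ PerNotTame ∧ TamePer (summit_iff_tame_split); ATTACK: PerNotTame ⟸
SensitiveHardPoly ∧ QuantHrubesPer (perNotTame_of_sensitive, realised inside `closes`). TAG WEAKER
(S ⟹ it, lens perNotTame_of_summit; converse = TamePer open); critic remark: budgets C ≤ 1 are
trivial (absEval P ≥ |P(𝟙)| = n! > 2^(n+1) for n ≥ 5), content starts at C = 2. Restricted-model
lower bound; monotone circuits are its cancellation-free corner. [difficulty: open-problem] -/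
@[route_item "route-ValiantsHypothesis-DecompCycle1"]
def PerNotTame : Prop :=
  ∀ (C : ℕ) (s : ℕ → ℕ), Literature.Computability.AlgebraicComplexity.IsPBounded s → ∃ n : ℕ, ∀ P : Literature.Computability.AlgebraicComplexity.ArithCircuit ℝ (Fin n × Fin n), P.IsFanInTwo → P.Computes (Literature.Computability.AlgebraicComplexity.perPoly (Fin n) ℝ) → P.size ≤ s n → (2 : ℝ) ^ (n ^ C + C) < MvPolynomial.eval (fun _ => (1 : ℝ)) (Literature.Computability.AlgebraicComplexity.ArithCircuit.mapConsts (fun c : ℝ => |c|) P).eval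

/-- item stmt-ValiantsHypothesis-23517 · aside (kind.auto-crux: conjecture-grade) · rank 9 · open · by planner
why it might fail: auto-crux — conjecture-grade statement (docstring avows it ('Open Problem')); it is open, so it may simply be false
sources: Hrubes2020, ChattopadhyayDattaMukhopadhyay2021, Srinivasan2022
[support] RUNG A₁ (bottom rung of SensitiveHardPoly, ε = 1; the BC5 first-rung / witness target of
the deciding crux, NOT a binder of `closes`): (1 + Σ_ij x_ij)^n + per_n is not monotone p-computable
— for every p-bounded s some n admits no monotone computation of U_n + per_n of size ≤ s n. This is
the (1+Σx)^n-form of Hrubeš 2020 §6 Open Problem 1 ("How about Π_i(Σ_j x_ij) + perm_n?", verified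
p.27 [corpus:paper:galaxy-pdf-8480837716326541740]). TAG WEAKER (SensitiveHardPoly ⟹ SensitiveHardAt
0 ⟹ it, writer sensitiveHardAtOne_of_sensitiveHardPoly; S ⟹ it); LEAF: ATTACKABLE NOW (i.o. form;
outside S's known regime: no monotone lower bound for a full-support perturbation of per is in
print; CDM21 Thm 1.2 is MOD3∘XOR, CDGM22 is the spanning-tree polynomial — per untouched,
critic-verified). [difficulty: L] -/
@[route_item "route-ValiantsHypothesis-DecompCycle1"]
def SensitiveHardAtOne : Prop :=
  ∀ s : ℕ → ℕ, Literature.Computability.AlgebraicComplexity.IsPBounded s → ∃ n : ℕ, ¬ (∃ (g : MvPolynomial (Fin n × Fin n) NNReal) (P : Literature.Computability.AlgebraicComplexity.ArithCircuit NNReal (Fin n × Fin n)), MvPolynomial.map NNReal.toRealHom g = (1 + ∑ ij : Fin n × Fin n, MvPolynomial.X ij) ^ n + MvPolynomial.C (1 : ℝ) * Literature.Computability.AlgebraicComplexity.perPoly (Fin n) ℝ ∧ Literature.Barriers.ValiantsHypothesis.IsMonotoneComputation P g ∧ P.size ≤ s n)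

/-- item stmt-ValiantsHypothesis-23752 · aside · rank 9 · open · by planner
[aside · KILL-PATH / ROAD under 23661 PerNotSmVP and 23662 TameOrSmLift — STRONGER than S; closes S
by Theorems.SmThreshold.closes; NEVER a closes binder; critic CLEARED 21:15:40Z, lens-6 g3 NODE v3
«SmThreshold»] PerSmExpHard (= Theorems.SmThreshold.PerSmExpHard, inlined: ∃ c, PerSmHardExp c): for
some block size c, for every polynomial budget a there is a block count m such that every fan-in-two
SYNTACTICALLY MULTILINEAR circuit over ℂ computing per_(mc) has more than a·(m+1)^a·4^m gates —
exponential sm hardness of the permanent at rate 2^((2/c)·n), i.o. along n ≡ 0 (mod c). Kernel facts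
(Theorems/SmThreshold.lean p743998+p744638, BlockLaplaceLift p743464, ColumnSubsetDP p744376; 0
sorry): the lifting side B_c = SmSubexpLift c (VP = VNP ⟹ sm circuits for per_(mc) of size ≤
a(m+1)^a·4^m) is PROVED FOR EVERY c (block Laplace expansion + exact-cover polynomial ∈ VNP + LST
Lemma 12; lifting loss = 4^(#blocks)); closes_at : PerSmHardExp c → SmSubexpLift c → VP ≠ VNP;
closes : PerSmExpHard → ValiantsHypothesis; c ≤ 2 REFUTED in kernel (column-subset DP,
not_perSmHardExp_zero/one/two) so PerSmExpHard ↔ ∃ c ≥ 3, PerSmHardExp c; PerSmExpHard → PerNotSmVP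
(23661); MultilinearRyserOptimal -/
@[route_item "route-ValiantsHypothesis-DecompCycle1", crux]
def PerSmExpHard : Prop :=
  ∃ c : ℕ, ∀ a : ℕ, ∃ m : ℕ, ∀ P : Literature.Computability.AlgebraicComplexity.ArithCircuit ℂ (Fin (m * c) × Fin (m * c)), P.IsFanInTwo → Literature.Computability.AlgebraicComplexity.IsSyntacticallyMultilinear P → P.Computes (Literature.Computability.AlgebraicComplexity.perPoly (Fin (m * c)) ℂ) → a * (m + 1) ^ a * 4 ^ m < P.size

/-- item stmt-ValiantsHypothesis-23801 · aside · rank 9 · open · by planner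
why it might fail: Given AS10_thm_10 it cannot fail without S failing (kernel S ⟹ A_nc ⟹ NcDetHard); unconditionally false iff the Cayley determinant has poly-size nc circuits; no superpolynomial nc CIRCUIT lower bound is known for any explicit polynomial (HWY10 p2), so as a target it may be as hard as A_nc.
sources: ArvindSrinivasan2010, HrubesWigdersonYehudayoff2011, Nisan1991Noncommutative
[aside · determinant face of 23446/23447 · lens-6 g5 NODE-v5 «CommutativityDial — LIFTING-AXIS
CLOSE-OUT» (Theorems/NcDeterminantFace.lean p753957), critic g2 CLEARED 2026-08-30T01:11:57Z ruling
(i): 'NcDetHard/DetLift ADMISSIBLE AS ASIDES «determinant face of 23446/23447» (writer's call) — NOT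
as a re-target of any binder'; placement record, NEVER a binder of closes] NcDetHard: the ORDERED
(Cayley) DETERMINANT has no polynomial-size noncommutative circuits, infinitely often — signature =
body of Summit.ValiantsHypothesis.ValiantsHypothesis.Theorems.NcDeterminantFace.NcDetHard INLINED
over the Literature nc semantics (Literature.Computability.AlgebraicComplexity.HasNcCircuitSizeLE,
Literature.Computability.AlgebraicComplexity.ncDetPoly of NoncommutativeCircuits.lean p753766: plain
defs, no @[conjecture] leaf; Iff.rfl to the tree decl, writer probe nc/detface_probe.lean rc 0).
PLACEMENT EDGES (kernel, modulo the Literature named fact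
Literature.Computability.AlgebraicComplexity.AS10_thm_10 = Arvind–Srinivasan 2010 Thm 10
[corpus:paper:arxiv-0910.2370 p7 L129], AS10CayleyDeterminant.lean p753848): S ⟹ PerNotNcVP (23446)
⟹ NcDetHard (NcDeterminantFace.ncDetHard_of_perNotNcVP, ncDetHar -/
@[route_item "route-ValiantsHypothesis-DecompCycle1"]
def NcDetHard : Prop :=
  ∀ c : ℕ, ∃ n : ℕ, ¬ Literature.Computability.AlgebraicComplexity.HasNcCircuitSizeLE (Literature.Computability.AlgebraicComplexity.ncDetPoly ℂ n) (n ^ c + c)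

/-- item stmt-ValiantsHypothesis-26003 · aside · rank 9 · closed · proved by Summit.ValiantsHypothesis.ValiantsHypothesis.Theorems.DecompCycle1PerNotSumOrderedId.perNotSumOrderedId_holds (planner) · by planner
why it might fail: Necessary for S (kernel perNotSumOrdered_of_vh): cannot fail unless S does. Unconditionally false iff per_n is a poly-total-width sum of n differently-ordered smABPs; the AR16 bound 2^{n/2t} is silent from t ≈ n/log n on (AR16 Rem 11 open); lens-6 w2 claims a proof (unverified).
sources: ArvindRaja2016, ChatterjeeKushSarafShpilka2024, Nisan1991Noncommutative, BhargavDwivediSaxena2024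
[aside · window point A_id of the SUPPORT-SIZE dial on the lifting axis under 23661 · lens-6 g6
NODE-v6 «OrderedCountWindow» (Theorems/OrderedCountWindow.lean p755721, …Rungs p756052, …Necessity
p756234), critic g2 CLEARED 2026-08-30T02:12:57Z R4: 'with w1 in kernel the aside PerNotSumOrdered
id under 23661 is ADMISSIBLE (writer's call; zero-sum w.r.t. closes, LESSON 6 — context, not
score)'; w1 LANDED p757552 Theorems/OrderedCountWindowPlacement.lean (b0d877457c1c) 02:56:44Z;
placement record, NEVER a binder of closes] PerNotSumOrderedId (A_id): for every exponent c,
infinitely often in n, per_n is NOT a sum of n ORDERED set-multilinear ABPs (each in its own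
variable order σ_i ∈ Perm(Fin n)) of TOTAL width ≤ n^c + c — the first point of the OPEN WINDOW
n/log n ≲ t ≤ poly(n) of the support-size dial A_t := PerNotSumOrdered t, and the open problem
stated by Arvind–Raja [corpus:paper:arxiv-1511.02308 p7 Remark 11 / Cor 12; quoted by CKSS24
arXiv:2312.15874 p5 L7–8 «support size t … at least 2^{Ω(n/t)} … t must be sub-linear»]. Signature =
body of
Summit.ValiantsHypothesis.ValiantsHypothesis.Theorems.OrderedCountWindowRungs.PerNotSumOrdered at t
= id, INLINED over the accepted plain d -/
@[route_item "route-ValiantsHypothesis-DecompCycle1"]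
def PerNotSumOrderedId : Prop :=
  ∀ c : ℕ, ∃ n : ℕ, ¬ Summit.ValiantsHypothesis.ValiantsHypothesis.Theorems.OrderedCountWindow.IsSumOrdered ℂ n n (n ^ c + c)

-- `PerNotSumOrderedId` holds: proved by `Summit.ValiantsHypothesis.ValiantsHypothesis.Theorems.DecompCycle1PerNotSumOrderedId.perNotSumOrderedId_holds` (its module imports this route file, so no `_holds` link can be stated here).

/-- item stmt-ValiantsHypothesis-23518 · assembly · rank 1 · closed · proved by Summit.ValiantsHypothesis.ValiantsHypothesis.Theorems.DecompCycle1Assembly.assembly_holds (planner) · by planner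
sources: Hrubes2020
[assembly] SensitiveHardPoly → TamePer → QuantHrubesPer → ValiantsHypothesis. -/
@[route_item "route-ValiantsHypothesis-DecompCycle1"]
def Assembly : Prop :=
  SensitiveHardPoly → TamePer → QuantHrubesPer → _root_.ValiantsHypothesis

-- `Assembly` holds: proved by `Summit.ValiantsHypothesis.ValiantsHypothesis.Theorems.DecompCycle1Assembly.assembly_holds` (its module imports this route file, so no `_holds` link can be stated here).

/-! D-0027 §2.1 — DECIDING THEOREM (planner-authored via `route open/edit --closes-file`; by planner-decomp-val-writer-1-g0-0 2026-08-29T18:07:34Z):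
its hypotheses are this route's items and its conclusion the sub-problem Statement (glue_lint), and it elaborates with this file. -/

@[closes "route-ValiantsHypothesis-DecompCycle1"] theorem closes (hA : SensitiveHardPoly) (hT : TamePer) (hQ : QuantHrubesPer) :
    _root_.ValiantsHypothesis := by
  -- internal AND-node T: PerNotTame ⟸ SensitiveHardPoly ∧ QuantHrubesPer (Hrubeš's bridge at ε = 2^-(n^C+C))
  have hN : PerNotTame := by
    intro C s hs
    obtain ⟨t, ht, hH⟩ := hQ
    obtain ⟨n, hn⟩ := hA C (fun n => t n (s n)) (ht s hs)
    refine ⟨n, fun P hfan hcomp hsize => ?_⟩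
    by_contra hle
    push Not at hle
    have hpow : (0 : ℝ) < (2 : ℝ) ^ (n ^ C + C) := pow_pos two_pos _
    have hr0 : (0 : ℝ) < ((2 : ℝ) ^ (n ^ C + C))⁻¹ := inv_pos.mpr hpow
    have hr1 : ((2 : ℝ) ^ (n ^ C + C))⁻¹ ≤ 1 := inv_le_one_of_one_le₀ (one_le_pow₀ (by norm_num))
    refine hn _ le_rfl hr1 (hH n P (s n) hfan hcomp hsize _ hr0 hr1 ?_)
    calc ((2 : ℝ) ^ (n ^ C + C))⁻¹ * MvPolynomial.eval (fun _ => (1 : ℝ)) (Literature.Computability.AlgebraicComplexity.ArithCircuit.mapConsts (fun c : ℝ => |c|) P).eval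
        ≤ ((2 : ℝ) ^ (n ^ C + C))⁻¹ * (2 : ℝ) ^ (n ^ C + C) := mul_le_mul_of_nonneg_left hle hr0.le
      _ = 1 := inv_mul_cancel₀ (pow_ne_zero _ two_ne_zero)
  -- root AND-node: S ⟸ PerNotTame ∧ TamePer, through `per ∉ VP_ℝ ⟹ S` (realification, Theorems.SymmetroidDescartes; Bürgisser 2000 Rem. 2.11)
  refine Literature.Computability.AlgebraicComplexity.perNotPComputableComplex_iff_holds.mp ?_
  intro hC
  have hVP := Summit.ValiantsHypothesis.ValiantsHypothesis.Theorems.SymmetroidDescartes.isPComputable_perPoly_real_of_complex hC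
  obtain ⟨C, s, hs, hP⟩ := hT hVP
  obtain ⟨n, hn⟩ := hN C s hs
  obtain ⟨P, hfan, hcomp, hsize, habs⟩ := hP n
  exact absurd habs (not_le_of_gt (hn P hfan hcomp hsize))

end Summit.ValiantsHypothesis.ValiantsHypothesis.Theses.DecompCycle1
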